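import Summits.CriticalPhenomena.PercolationContinuityZ3.Theses.PercNonProliferation
import Summits.CriticalPhenomena.PercolationContinuityZ3.Theorems.SubpolynomialBlocking.Negative.Strengthenings
import Summits.CriticalPhenomena.PercolationContinuityZ3.Theorems.PercNonProliferationSubpolynomialBlockingStubSixSlab
import Summits.CriticalPhenomena.PercolationContinuityZ3.Theorems.PercNonProliferationSubpolynomialBlockingStubTiling
import Summits.CriticalPhenomena.PercolationContinuityZ3.Theorems.PercNonProliferationSubpolynomialBlockingStubUpperSandwich
import Summits.CriticalPhenomena.PercolationContinuityZ3.Theorems.PercNonProliferationSubpolynomialBlockingStubUpperSeedSandwich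
import Summits.CriticalPhenomena.PercolationContinuityZ3.Theorems.PercNonProliferationSubpolynomialBlockingStubCruxImpliesAnchor
import Summits.CriticalPhenomena.PercolationContinuityZ3.Theorems.PercNonProliferationSubpolynomialBlockingStubCruxOfComparisonOfAnchor
import Summits.CriticalPhenomena.PercolationContinuityZ3.Theorems.PercNonProliferationSubpolynomialBlockingStubCruxIffSeedSubpoly
import Literature.Probability.Percolation.Crossings

/-!
# Skeleton of line `cross-sandwich-flat-seal` for crux `SubpolynomialBlocking` (stmt-CriticalPhenomena-4446)

Lead's skeleton (prover-line-stmt-CriticalPhenomena-4446-0; continued by -c1-0, -c4-0 and -c5-0), reshaped from the planner's checked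
`Lines/cross-sandwich-flat-seal.lean` (crux-plan r1): SAME composition, two changes.
(1) Every object is stated in TREE VOCABULARY — a coordinate box is `Set.Icc a b` for the product
order on `Site 3 = Fin 3 → ℤ`, a sealing event is the complement of
`Literature.Probability.Percolation.openCrossing` between the two faces — and every registered stub
signature is fully inlined, so that each stub lands under `Theorems/` with NO new definition
(helpers `--supports stmt-CriticalPhenomena-4446` are matched against these signatures).
(2) The necessity side `u_n ≤ q_n⁶` (planner's hypothesis `UpperSandwich`) is REGISTERED as
`stub_upperSandwich` (M, provable now), so that `cubeSealSubpoly_of_crux` — "the anchor is necessary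
for the crux" — becomes a certified theorem once it lands: any kill of the anchor kills the crux.

Crux: `PercNonProliferation.SubpolynomialBlocking` = `∀ s > 0, ∀ᶠ n, n^{-s} ≤ u_n`,
`u_n := P_{p_c(ℤ³)}(Λ_n ↮ ∂ⁱⁿΛ_{2n} inside Λ_{2n}) = Negative.blockProb 3 p_c n` (`Negative.crux_iff`, `Iff.rfl`).

## The line (all probabilities at `p = p_c(ℤ³)`; seals are across direction `0`)

* `V n`      — seal of the face-slab `[n,2n] × [-2n,2n]²` (no open path inside it from `{x₀=n}` to `{x₀=2n}`);
* `seed k n` — seal of the flat seed `[0,n] × [0, n+⌊n/k⌋]²` (aspect ratio `1 + 1/k`);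
* `q n`      — seal of the cube `[0,n]³`.

  `u_n ≥ V_n⁶`                 STUB `stub_sixSlab` (M, provable now: `shell_cutsets_glue` + Harris ×5 + symmetry)
  `V_n ≥ seed_k(n)^K`          STUB `stub_tiling` (L, provable now: Union-Lemma tiling `cutsets_glue`/`cutset_restrict` + Harris)
  `seed_k(n) ≥ c q_n^C` (∃k)   STUB `stub_comparison` (XL, OPEN, HARDEST — RSW for plaquettes BY AN INCH; the lead's)
  `q_n ≥ n^{-o(1)}`            STUB `stub_anchor` (XL, OPEN; NECESSARY for the crux)
  `u_n ≤ q_n⁶`                 STUB `stub_upperSandwich` (M, provable now: six vertex-disjoint cubes, independence; necessity certificate)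

`SubpolynomialBlocking_of : stub_sixSlab → stub_tiling → stub_comparison → stub_anchor → crux` (by name, no sorry).
Only fixed POWERS of probabilities and positive constants are lost along the chain, which the `∀ s` target absorbs
(`exists_eventually_rpow_le`); a fixed polynomial FACTOR `n^{-C}` would not be absorbed, and none occurs.

## Helpers landed around this skeleton by later leads (all `--supports 4446`, namespace `…Theorems.SubpolynomialBlocking`)
c4: `stub_comparisonGrowing` (p120396: the inch holds with the growing power `3(⌊n/k⌋+1)²`, every `p`),
`stub_blockingDistanceTail` (p120761), `stub_blockerRSWGlue` (p121157: sibling items 1129 ∧ 1141 ⇒ crux).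
c5: `stub_anchorOfCubeBlockingSeed` (p122294: sibling `CubeBlockingSeed` 1141 ⇒ `stub_anchor`),
`stub_comparisonOfBlockerRSWOfSeed` (p122544: 1129 ∧ 1141 ⇒ `stub_comparison`, `k = 1`, `C = 0`),
`meanSpanningSubpoly_of_subpolynomialBlocking` (p122328: crux + `SpanningBKCap` ⇒ `E_{p_c}[N_n] ≤ n^s` eventually, every `s > 0`),
`theta_sq_le_meanSpanning_mul_pairConnectivity` + `percolationContinuityZ3_of_exponents` (p122354: `θ(p)² ≤ 64·E_p[N_n]·FA₂ᵖ(2n)`;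
the polynomial pair closes the conjunct from `FA₂ ≤ C n^{-a}` and `E[N_n] ≤ C' n^b` frequently with `b < a` — the route consumes the crux
only as "mean spanning number sub-polynomial"). The two `sorry`s below are unchanged: they are the crux-hard core (RSW inch; hyperscaling anchor).

## Disproof used (`Cruxes/SubpolynomialBlocking/Disproof.lean`, cdisprove cycle 1; landed Negative lane imported)
§2 (`p ≤ p_c` load-bearing) and §4 (`d ≤ 6` load-bearing): localised at `stub_anchor` (stubs 1, 2, 5 hold at every `p`
and in every `d`; stub 3 is expected `p`-uniform). §6 refuted strengthenings: no stub has the `s`-uniform / `s = 0` /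
`∀ n ≥ 1` shape. §7: `u_pos`, `u_lt_one` readbacks. §8 Targets: none yet. No stub instantiates a landed Negative lemma.
-/

noncomputable section

namespace Summit.CriticalPhenomena.PercolationContinuityZ3.Cruxes.SubpolynomialBlocking.CrossSandwichFlatSeal

open MeasureTheory Filter Topology
open Literature.Probability.Percolation Literature.Probability.LatticeModels
open Summit.CriticalPhenomena.PercolationContinuityZ3.Theorems.SubpolynomialBlocking.Negative
open Summit.CriticalPhenomena.PercolationContinuityZ3.Theses

/-! ### Objects (tree vocabulary: `Set.Icc` boxes, `openCrossing` between faces) -/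

/-- The critical bond measure `P_{p_c}` on `ℤ³`. -/
abbrev μc : Measure (BondConfig (Site 3)) := bondPercolation (zdGraph 3) (criticalProbI 3)

/-- SEALING EVENT of the coordinate box `Set.Icc a b = {x | a ≤ x ≤ b}` (product order on `Fin 3 → ℤ`) across
direction `i`: NO open path inside the box joins its face `{x i = a i}` to its face `{x i = b i}`. Decreasing;
determined by the edges inside the box. Written with the tree's `openCrossing S A B = {∃ x ∈ A, ∃ y ∈ B, x ↔ y in S}`. -/
abbrev sealEv (a b : Site 3) (i : Fin 3) : Set (BondConfig (Site 3)) :=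
  (openCrossing (Set.Icc a b) {x | x ∈ Set.Icc a b ∧ x i = a i} {y | y ∈ Set.Icc a b ∧ y i = b i})ᶜ

/-- `u n`: the crux's blocking probability (landed vocabulary `Negative.blockProb`). -/
abbrev u (n : ℕ) : ℝ := blockProb 3 (criticalProbI 3) n

/-- Lower / upper corners of the top face-slab `[n,2n] × [-2n,2n]²` of the annulus `Λ_{2n} ∖ Λ_n`. -/
abbrev slabLo (n : ℕ) : Site 3 := ![(n : ℤ), -(2 * (n : ℤ)), -(2 * (n : ℤ))]
/-- See `slabLo`. -/
abbrev slabHi (n : ℕ) : Site 3 := ![2 * (n : ℤ), 2 * (n : ℤ), 2 * (n : ℤ)]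
/-- Upper corner of the flat seed `[0,n] × [0, n + ⌊n/k⌋]²` (lower corner `0`). -/
abbrev seedHi (k n : ℕ) : Site 3 := ![(n : ℤ), (n : ℤ) + (n / k : ℕ), (n : ℤ) + (n / k : ℕ)]
/-- Upper corner of the cube `[0,n]³`. -/
abbrev cubeHi (n : ℕ) : Site 3 := ![(n : ℤ), (n : ℤ), (n : ℤ)]

/-- `V n`: the face-slab sealed across its thin direction `0`. -/
def V (n : ℕ) : ℝ := μc.real (sealEv (slabLo n) (slabHi n) 0)
/-- `seed k n`: the flat seed of aspect ratio `1 + 1/k` sealed across its thin direction `0`. -/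
def seed (k n : ℕ) : ℝ := μc.real (sealEv 0 (seedHi k n) 0)
/-- `q n`: the cube `[0,n]³` sealed between `{x₀ = 0}` and `{x₀ = n}` — the ANCHOR object. -/
def q (n : ℕ) : ℝ := μc.real (sealEv 0 (cubeHi n) 0)

theorem V_nonneg (n : ℕ) : 0 ≤ V n := measureReal_nonneg
theorem seed_nonneg (k n : ℕ) : 0 ≤ seed k n := measureReal_nonneg
theorem q_nonneg (n : ℕ) : 0 ≤ q n := measureReal_nonneg
theorem q_le_one (n : ℕ) : q n ≤ 1 := measureReal_le_one

/-- Landed negative knowledge (readback): `0 < u n < 1` for `n ≥ 1`. -/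
theorem u_pos_lt_one {n : ℕ} (hn : 1 ≤ n) : 0 < u n ∧ u n < 1 :=
  ⟨blockProb_criticalProb_three_pos hn, blockProb_criticalProb_three_lt_one n⟩

/-! ### The five statements (named `Prop`s) -/

/-- STUB 1 statement: `V_n⁶ ≤ u_n` (`n ≥ 1`). -/
def SixSlabSandwich : Prop := ∀ n : ℕ, 1 ≤ n → V n ^ 6 ≤ u n

/-- STUB 2 statement: `∀ k ≥ 1, ∃ K N, ∀ n ≥ N, seed_k(n)^K ≤ V_n` (`K = (12k+1)²`, `N = 2k` do). -/
def SeedTiling : Prop := ∀ k : ℕ, 1 ≤ k → ∃ K N : ℕ, ∀ n : ℕ, N ≤ n → seed k n ^ K ≤ V n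

/-- STUB 3 statement (COMPARISON, open, hardest): `∃ k ≥ 1, ∃ C c > 0, ∀ᶠ n, c q_n^C ≤ seed_k(n)`. -/
def SeedFromCube : Prop :=
  ∃ k : ℕ, 1 ≤ k ∧ ∃ (C : ℕ) (c : ℝ), 0 < c ∧ ∀ᶠ n : ℕ in atTop, c * q n ^ C ≤ seed k n

/-- STUB 4 statement (ANCHOR, open, necessary): `∀ s > 0, ∀ᶠ n, n^{-s} ≤ q_n`. -/
def CubeSealSubpoly : Prop := ∀ s : ℝ, 0 < s → ∀ᶠ n : ℕ in atTop, (n : ℝ) ^ (-s) ≤ q n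

/-- STUB 5 statement (UPPER SANDWICH, necessity certificate): `u_n ≤ q_n⁶` (`n ≥ 2`). -/
def UpperSandwich : Prop := ∀ n : ℕ, 2 ≤ n → u n ≤ q n ^ 6

/-- STUB 6 statement (UPPER SEED SANDWICH, second necessity certificate): `u_n ≤ seed_k(n)⁶` (`k ≥ 2`, `n ≥ 3`). -/
def UpperSeedSandwich : Prop := ∀ k n : ℕ, 2 ≤ k → 3 ≤ n → u n ≤ seed k n ^ 6

/-- The card's transfer target: the flat seed of aspect parameter `k` is sub-polynomial. EQUIVALENT to the crux for
every `k ≥ 2` (`crux_iff_seedSubpoly`). -/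
def SeedSubpoly (k : ℕ) : Prop := ∀ s : ℝ, 0 < s → ∀ᶠ n : ℕ in atTop, (n : ℝ) ^ (-s) ≤ seed k n

/-! ### Registered stubs (the ONLY `sorry`s of this file; signatures fully inlined in tree vocabulary) -/

/-- STUB 1 (M) — LANDED p82361 (`Theorems/PercNonProliferationSubpolynomialBlockingStubSixSlab.lean`): six face-slab seals close the shell (`shell_cutsets_glue`), Harris ×5, symmetry. -/
theorem stub_sixSlab :
    ∀ n : ℕ, 1 ≤ n →
      (bondPercolation (zdGraph 3) (criticalProbI 3)).real
          (openCrossing (Set.Icc (![(n : ℤ), -(2 * (n : ℤ)), -(2 * (n : ℤ))] : Site 3)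
              ![2 * (n : ℤ), 2 * (n : ℤ), 2 * (n : ℤ)])
            {x | x ∈ Set.Icc (![(n : ℤ), -(2 * (n : ℤ)), -(2 * (n : ℤ))] : Site 3)
              ![2 * (n : ℤ), 2 * (n : ℤ), 2 * (n : ℤ)] ∧ x 0 = (n : ℤ)}
            {y | y ∈ Set.Icc (![(n : ℤ), -(2 * (n : ℤ)), -(2 * (n : ℤ))] : Site 3)
              ![2 * (n : ℤ), 2 * (n : ℤ), 2 * (n : ℤ)] ∧ y 0 = 2 * (n : ℤ)})ᶜ ^ 6 ≤
        blockProb 3 (criticalProbI 3) n := 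
  Theorems.SubpolynomialBlocking.stub_sixSlab

/-- STUB 2 (L) — LANDED p80188 (`Theorems/PercNonProliferationSubpolynomialBlockingStubTiling.lean`): Union-Lemma tiling (`cutsets_glue`, `cutset_restrict`) + Harris. -/
theorem stub_tiling :
    ∀ k : ℕ, 1 ≤ k → ∃ K N : ℕ, ∀ n : ℕ, N ≤ n →
      (bondPercolation (zdGraph 3) (criticalProbI 3)).real
          (openCrossing (Set.Icc (0 : Site 3) ![(n : ℤ), (n : ℤ) + (n / k : ℕ), (n : ℤ) + (n / k : ℕ)])
            {x | x ∈ Set.Icc (0 : Site 3) ![(n : ℤ), (n : ℤ) + (n / k : ℕ), (n : ℤ) + (n / k : ℕ)] ∧ x 0 = 0}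
            {y | y ∈ Set.Icc (0 : Site 3) ![(n : ℤ), (n : ℤ) + (n / k : ℕ), (n : ℤ) + (n / k : ℕ)] ∧
              y 0 = (n : ℤ)})ᶜ ^ K ≤
        (bondPercolation (zdGraph 3) (criticalProbI 3)).real
          (openCrossing (Set.Icc (![(n : ℤ), -(2 * (n : ℤ)), -(2 * (n : ℤ))] : Site 3)
              ![2 * (n : ℤ), 2 * (n : ℤ), 2 * (n : ℤ)])
            {x | x ∈ Set.Icc (![(n : ℤ), -(2 * (n : ℤ)), -(2 * (n : ℤ))] : Site 3)
              ![2 * (n : ℤ), 2 * (n : ℤ), 2 * (n : ℤ)] ∧ x 0 = (n : ℤ)}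
            {y | y ∈ Set.Icc (![(n : ℤ), -(2 * (n : ℤ)), -(2 * (n : ℤ))] : Site 3)
              ![2 * (n : ℤ), 2 * (n : ℤ), 2 * (n : ℤ)] ∧ y 0 = 2 * (n : ℤ)})ᶜ := 
  Theorems.SubpolynomialBlocking.stub_tiling

/-- STUB 3 (XL, OPEN, HARDEST) — RSW for plaquettes in cubes, by an inch, powers only, at `p_c(ℤ³)`. -/
theorem stub_comparison :
    ∃ k : ℕ, 1 ≤ k ∧ ∃ (C : ℕ) (c : ℝ), 0 < c ∧ ∀ᶠ n : ℕ in atTop,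
      c * (bondPercolation (zdGraph 3) (criticalProbI 3)).real
          (openCrossing (Set.Icc (0 : Site 3) ![(n : ℤ), (n : ℤ), (n : ℤ)])
            {x | x ∈ Set.Icc (0 : Site 3) ![(n : ℤ), (n : ℤ), (n : ℤ)] ∧ x 0 = 0}
            {y | y ∈ Set.Icc (0 : Site 3) ![(n : ℤ), (n : ℤ), (n : ℤ)] ∧ y 0 = (n : ℤ)})ᶜ ^ C ≤
        (bondPercolation (zdGraph 3) (criticalProbI 3)).real
          (openCrossing (Set.Icc (0 : Site 3) ![(n : ℤ), (n : ℤ) + (n / k : ℕ), (n : ℤ) + (n / k : ℕ)])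
            {x | x ∈ Set.Icc (0 : Site 3) ![(n : ℤ), (n : ℤ) + (n / k : ℕ), (n : ℤ) + (n / k : ℕ)] ∧ x 0 = 0}
            {y | y ∈ Set.Icc (0 : Site 3) ![(n : ℤ), (n : ℤ) + (n / k : ℕ), (n : ℤ) + (n / k : ℕ)] ∧
              y 0 = (n : ℤ)})ᶜ := by
  sorry

/-- STUB 4 (XL, OPEN; NECESSARY for the crux) — the critical cube seal is sub-polynomial. -/
theorem stub_anchor :
    ∀ s : ℝ, 0 < s → ∀ᶠ n : ℕ in atTop,
      (n : ℝ) ^ (-s) ≤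
        (bondPercolation (zdGraph 3) (criticalProbI 3)).real
          (openCrossing (Set.Icc (0 : Site 3) ![(n : ℤ), (n : ℤ), (n : ℤ)])
            {x | x ∈ Set.Icc (0 : Site 3) ![(n : ℤ), (n : ℤ), (n : ℤ)] ∧ x 0 = 0}
            {y | y ∈ Set.Icc (0 : Site 3) ![(n : ℤ), (n : ℤ), (n : ℤ)] ∧ y 0 = (n : ℤ)})ᶜ := by
  sorry

/-- STUB 5 (M; necessity certificate) — LANDED p82007 (`Theorems/PercNonProliferationSubpolynomialBlockingStubUpperSandwich.lean`): `u_n ≤ q_n⁶` for `n ≥ 2`: the blocking event lies in the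
sealing event of each of the six pairwise vertex-disjoint cubes `[n,2n] × [-(n-1),1]²` (and signed-permutation
images); independence of events determined by disjoint edge sets; each has probability `q_n`. -/
theorem stub_upperSandwich :
    ∀ n : ℕ, 2 ≤ n →
      blockProb 3 (criticalProbI 3) n ≤
        (bondPercolation (zdGraph 3) (criticalProbI 3)).real
          (openCrossing (Set.Icc (0 : Site 3) ![(n : ℤ), (n : ℤ), (n : ℤ)])
            {x | x ∈ Set.Icc (0 : Site 3) ![(n : ℤ), (n : ℤ), (n : ℤ)] ∧ x 0 = 0}
            {y | y ∈ Set.Icc (0 : Site 3) ![(n : ℤ), (n : ℤ), (n : ℤ)] ∧ y 0 = (n : ℤ)})ᶜ ^ 6 := 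
  Theorems.SubpolynomialBlocking.stub_upperSandwich

/-- STUB 6 (M; second necessity certificate) — LANDED p84567 (`…StubUpperSeedSandwich.lean`): `u_n ≤ seed_k(n)⁶` for `k ≥ 2`, `n ≥ 3`: the blocking event
lies in the sealing event of each of the six pairwise vertex-disjoint flat seeds
`{±x_i ∈ [n,2n], other coordinates ∈ [-(n-1), ⌊n/k⌋+1]}` (inner face inside `Λ_n` because `⌊n/k⌋+1 ≤ n`; pairwise disjoint because
`⌊n/k⌋+1 < n` for `k ≥ 2`, `n ≥ 3`); independence of events determined by disjoint edge sets; each has probability `seed_k(n)`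
(same proof as `stub_upperSandwich` with the cube replaced by the seed). With stubs 1–2 it makes the crux EQUIVALENT to
`SeedSubpoly k` for every `k ≥ 2` (`crux_iff_seedSubpoly`). -/
theorem stub_upperSeedSandwich :
    ∀ k n : ℕ, 2 ≤ k → 3 ≤ n →
      blockProb 3 (criticalProbI 3) n ≤
        (bondPercolation (zdGraph 3) (criticalProbI 3)).real
          (openCrossing (Set.Icc (0 : Site 3) ![(n : ℤ), (n : ℤ) + (n / k : ℕ), (n : ℤ) + (n / k : ℕ)])
            {x | x ∈ Set.Icc (0 : Site 3) ![(n : ℤ), (n : ℤ) + (n / k : ℕ), (n : ℤ) + (n / k : ℕ)] ∧ x 0 = 0}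
            {y | y ∈ Set.Icc (0 : Site 3) ![(n : ℤ), (n : ℤ) + (n / k : ℕ), (n : ℤ) + (n / k : ℕ)] ∧
              y 0 = (n : ℤ)})ᶜ ^ 6 := 
  Theorems.SubpolynomialBlocking.stub_upperSeedSandwich

/-- STUB 7 (S; certified REDUCTION, the lead's) — LANDED (`…StubCruxIffSeedSubpoly.lean`): the crux is EQUIVALENT to the
sub-polynomial flat seal of ONE aspect ratio `1 + 1/k`, for every `k ≥ 2` (statement fully inlined: right-hand side is
`SeedSubpoly k`). Landing it puts the reduction "annulus blocking ⟺ one flat box" in the tree. -/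
theorem stub_cruxIffSeedSubpoly :
    ∀ k : ℕ, 2 ≤ k →
      (Summit.CriticalPhenomena.PercolationContinuityZ3.Theses.PercNonProliferation.SubpolynomialBlocking ↔
        ∀ s : ℝ, 0 < s → ∀ᶠ n : ℕ in atTop,
          (n : ℝ) ^ (-s) ≤
            (bondPercolation (zdGraph 3) (criticalProbI 3)).real
              (openCrossing (Set.Icc (0 : Site 3) ![(n : ℤ), (n : ℤ) + (n / k : ℕ), (n : ℤ) + (n / k : ℕ)])
                {x | x ∈ Set.Icc (0 : Site 3) ![(n : ℤ), (n : ℤ) + (n / k : ℕ), (n : ℤ) + (n / k : ℕ)] ∧ x 0 = 0}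
                {y | y ∈ Set.Icc (0 : Site 3) ![(n : ℤ), (n : ℤ) + (n / k : ℕ), (n : ℤ) + (n / k : ℕ)] ∧
                  y 0 = (n : ℤ)})ᶜ) := 
  Theorems.SubpolynomialBlocking.stub_cruxIffSeedSubpoly

/-- STUB 8 (S; certified NECESSITY of the anchor, the lead's) — LANDED p85067 (`…StubCruxImpliesAnchor.lean`): the crux implies that the
critical cube seal is sub-polynomial (statement fully inlined: conclusion is `CubeSealSubpoly`). -/
theorem stub_cruxImpliesAnchor :
    Summit.CriticalPhenomena.PercolationContinuityZ3.Theses.PercNonProliferation.SubpolynomialBlocking →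
      ∀ s : ℝ, 0 < s → ∀ᶠ n : ℕ in atTop,
        (n : ℝ) ^ (-s) ≤
          (bondPercolation (zdGraph 3) (criticalProbI 3)).real
            (openCrossing (Set.Icc (0 : Site 3) ![(n : ℤ), (n : ℤ), (n : ℤ)])
              {x | x ∈ Set.Icc (0 : Site 3) ![(n : ℤ), (n : ℤ), (n : ℤ)] ∧ x 0 = 0}
              {y | y ∈ Set.Icc (0 : Site 3) ![(n : ℤ), (n : ℤ), (n : ℤ)] ∧ y 0 = (n : ℤ)})ᶜ := 
  Theorems.SubpolynomialBlocking.stub_cruxImpliesAnchor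

/-- STUB 9 (S; the COMPOSITION as a tree theorem, the lead's) — LANDED p85499 (`…StubCruxOfComparisonOfAnchor.lean`):
comparison ∧ anchor ⇒ crux, with both hypotheses fully inlined (`SeedFromCube → CubeSealSubpoly → crux`, the crux in
its landed parametrised form `Negative.SubpolynomialBlockingAt 3 p_c`, which is the route decl by `Negative.crux_iff = Iff.rfl`;
this keeps `SubpolynomialBlocking_proof` the unique theorem of the file concluding the crux BY NAME). Landing it
makes the line's reduction citeable: if the two open stubs are promoted to items, this theorem is their assembly. -/
theorem stub_cruxOfComparisonOfAnchor :
    (∃ k : ℕ, 1 ≤ k ∧ ∃ (C : ℕ) (c : ℝ), 0 < c ∧ ∀ᶠ n : ℕ in atTop,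
      c * (bondPercolation (zdGraph 3) (criticalProbI 3)).real
          (openCrossing (Set.Icc (0 : Site 3) ![(n : ℤ), (n : ℤ), (n : ℤ)])
            {x | x ∈ Set.Icc (0 : Site 3) ![(n : ℤ), (n : ℤ), (n : ℤ)] ∧ x 0 = 0}
            {y | y ∈ Set.Icc (0 : Site 3) ![(n : ℤ), (n : ℤ), (n : ℤ)] ∧ y 0 = (n : ℤ)})ᶜ ^ C ≤
        (bondPercolation (zdGraph 3) (criticalProbI 3)).real
          (openCrossing (Set.Icc (0 : Site 3) ![(n : ℤ), (n : ℤ) + (n / k : ℕ), (n : ℤ) + (n / k : ℕ)])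
            {x | x ∈ Set.Icc (0 : Site 3) ![(n : ℤ), (n : ℤ) + (n / k : ℕ), (n : ℤ) + (n / k : ℕ)] ∧ x 0 = 0}
            {y | y ∈ Set.Icc (0 : Site 3) ![(n : ℤ), (n : ℤ) + (n / k : ℕ), (n : ℤ) + (n / k : ℕ)] ∧
              y 0 = (n : ℤ)})ᶜ) →
    (∀ s : ℝ, 0 < s → ∀ᶠ n : ℕ in atTop,
      (n : ℝ) ^ (-s) ≤
        (bondPercolation (zdGraph 3) (criticalProbI 3)).real
          (openCrossing (Set.Icc (0 : Site 3) ![(n : ℤ), (n : ℤ), (n : ℤ)])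
            {x | x ∈ Set.Icc (0 : Site 3) ![(n : ℤ), (n : ℤ), (n : ℤ)] ∧ x 0 = 0}
            {y | y ∈ Set.Icc (0 : Site 3) ![(n : ℤ), (n : ℤ), (n : ℤ)] ∧ y 0 = (n : ℤ)})ᶜ) →
    SubpolynomialBlockingAt 3 (criticalProbI 3) := 
  Theorems.SubpolynomialBlocking.stub_cruxOfComparisonOfAnchor

/-! ### Consistency: each named statement IS its registered stub (definitionally) -/

theorem sixSlabSandwich_holds : SixSlabSandwich := stub_sixSlab
theorem seedTiling_holds : SeedTiling := stub_tiling
theorem seedFromCube_holds : SeedFromCube := stub_comparison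
theorem cubeSealSubpoly_holds : CubeSealSubpoly := stub_anchor
theorem upperSandwich_holds : UpperSandwich := stub_upperSandwich
theorem upperSeedSandwich_holds : UpperSeedSandwich := stub_upperSeedSandwich
theorem cruxIffSeedSubpoly_holds (k : ℕ) (hk : 2 ≤ k) :
    (Theses.PercNonProliferation.SubpolynomialBlocking ↔ SeedSubpoly k) := stub_cruxIffSeedSubpoly k hk
theorem cruxImpliesAnchor_holds : Theses.PercNonProliferation.SubpolynomialBlocking → CubeSealSubpoly :=
  stub_cruxImpliesAnchor
theorem cruxOfComparisonOfAnchor_holds :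
    SeedFromCube → CubeSealSubpoly → SubpolynomialBlockingAt 3 (criticalProbI 3) :=
  stub_cruxOfComparisonOfAnchor

/-! ### Name-keyed aliases (hypotheses of the composition) -/
namespace Registered

/-- Alias of `SixSlabSandwich` keyed by the registered stub name. -/
abbrev stub_sixSlab : Prop := SixSlabSandwich
/-- Alias of `SeedTiling` keyed by the registered stub name. -/
abbrev stub_tiling : Prop := SeedTiling
/-- Alias of `SeedFromCube` keyed by the registered stub name. -/
abbrev stub_comparison : Prop := SeedFromCube
/-- Alias of `CubeSealSubpoly` keyed by the registered stub name. -/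
abbrev stub_anchor : Prop := CubeSealSubpoly
/-- Alias of `UpperSandwich` keyed by the registered stub name. -/
abbrev stub_upperSandwich : Prop := UpperSandwich
/-- Alias of `UpperSeedSandwich` keyed by the registered stub name. -/
abbrev stub_upperSeedSandwich : Prop := UpperSeedSandwich

end Registered

/-! ### Glue (PROVED): sub-polynomial bounds survive fixed powers and positive constants -/

/-- For `s > 0`, `c > 0` and a fixed power `M` there is `t > 0` with `n^{-s} ≤ c · (n^{-t})^M` for all large `n`
(`t = s / (2(M+1))`). -/
theorem exists_eventually_rpow_le {s c : ℝ} (hs : 0 < s) (hc : 0 < c) (M : ℕ) :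
    ∃ t : ℝ, 0 < t ∧ ∀ᶠ n : ℕ in atTop, (n : ℝ) ^ (-s) ≤ c * ((n : ℝ) ^ (-t)) ^ M := by
  refine ⟨s / (2 * (M + 1)), by positivity, ?_⟩
  have h1 : ∀ᶠ n : ℕ in atTop, (n : ℝ) ^ (-(s / 2)) < c :=
    ((tendsto_rpow_neg_atTop (by positivity : 0 < s / 2)).comp tendsto_natCast_atTop_atTop).eventually
      (gt_mem_nhds hc)
  filter_upwards [h1, eventually_ge_atTop 1] with n h1 hn
  have hn1 : (1 : ℝ) ≤ n := by exact_mod_cast hn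
  have hn0 : (0 : ℝ) < n := by linarith
  rw [← Real.rpow_natCast, ← Real.rpow_mul hn0.le]
  have hsplit : (n : ℝ) ^ (-s) = (n : ℝ) ^ (-(s / 2)) * (n : ℝ) ^ (-(s / 2)) := by
    rw [← Real.rpow_add hn0]; ring_nf
  rw [hsplit]
  refine mul_le_mul h1.le ?_ (Real.rpow_nonneg hn0.le _) hc.le
  refine Real.rpow_le_rpow_of_exponent_le hn1 ?_
  have hM : (0 : ℝ) ≤ M := by positivity
  have hM1 : (0 : ℝ) < 2 * (M + 1) := by positivity
  have key : s / (2 * (M + 1)) * M ≤ s / 2 := by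
    rw [div_mul_eq_mul_div, div_le_div_iff₀ hM1 two_pos]
    nlinarith
  linarith

/-- Stubs 3 + 4 ⇒ the flat seed of the comparison's aspect parameter is sub-polynomial. -/
theorem seedSubpoly_of {k C : ℕ} {c : ℝ} (hc : 0 < c)
    (hcmp : ∀ᶠ n : ℕ in atTop, c * q n ^ C ≤ seed k n) (hA : CubeSealSubpoly) : SeedSubpoly k := by
  intro s hs
  obtain ⟨t, ht, hev⟩ := exists_eventually_rpow_le hs hc C
  filter_upwards [hev, hA t ht, hcmp] with n h1 h2 h3
  have h0 : (0 : ℝ) ≤ (n : ℝ) ^ (-t) := Real.rpow_nonneg (Nat.cast_nonneg n) _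
  calc (n : ℝ) ^ (-s) ≤ c * ((n : ℝ) ^ (-t)) ^ C := h1
    _ ≤ c * q n ^ C := mul_le_mul_of_nonneg_left (pow_le_pow_left₀ h0 h2 C) hc.le
    _ ≤ seed k n := h3

/-- Stubs 1 + 2 ⇒ the TRANSFER: a sub-polynomial flat seal (any one `k ≥ 1`) gives the crux, in the landed form
`SubpolynomialBlockingAt 3 p_c`. -/
theorem subpolynomialBlockingAt_of_seedSubpoly (h6 : SixSlabSandwich) (hT : SeedTiling) {k : ℕ}
    (hk : 1 ≤ k) (hS : SeedSubpoly k) : SubpolynomialBlockingAt 3 (criticalProbI 3) := by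
  rw [subpolynomialBlockingAt_iff]
  intro s hs
  obtain ⟨K, N, hKN⟩ := hT k hk
  obtain ⟨t, ht, hev⟩ := exists_eventually_rpow_le hs one_pos (6 * K)
  filter_upwards [hev, hS t ht, eventually_ge_atTop (max N 1)] with n h1 h2 hn
  have hnN : N ≤ n := le_of_max_le_left hn
  have hn1 : 1 ≤ n := le_of_max_le_right hn
  have h0 : (0 : ℝ) ≤ (n : ℝ) ^ (-t) := Real.rpow_nonneg (Nat.cast_nonneg n) _
  calc (n : ℝ) ^ (-s) ≤ 1 * ((n : ℝ) ^ (-t)) ^ (6 * K) := h1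
    _ ≤ seed k n ^ (6 * K) := by rw [one_mul]; exact pow_le_pow_left₀ h0 h2 _
    _ = (seed k n ^ K) ^ 6 := by rw [pow_mul']
    _ ≤ V n ^ 6 := pow_le_pow_left₀ (pow_nonneg (seed_nonneg k n) K) (hKN n hnN) 6
    _ ≤ blockProb 3 (criticalProbI 3) n := h6 n hn1

/-- The four statements ⇒ `SubpolynomialBlockingAt 3 p_c`. -/
theorem subpolynomialBlockingAt_of (h6 : SixSlabSandwich) (hT : SeedTiling) (hC : SeedFromCube)
    (hA : CubeSealSubpoly) : SubpolynomialBlockingAt 3 (criticalProbI 3) := by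
  obtain ⟨k, hk, C, c, hc, hcmp⟩ := hC
  exact subpolynomialBlockingAt_of_seedSubpoly h6 hT hk (seedSubpoly_of hc hcmp hA)

/-- NECESSITY of the anchor: the upper sandwich and the crux give `CubeSealSubpoly` (`n^{-6s} ≤ u_n ≤ q_n⁶`).
With `stub_upperSandwich` landed this is unconditional in its first argument (`upperSandwich_holds`). -/
theorem cubeSealSubpoly_of_crux (hU : UpperSandwich) (h : SubpolynomialBlockingAt 3 (criticalProbI 3)) :
    CubeSealSubpoly := by
  rw [subpolynomialBlockingAt_iff] at h
  intro s hs
  filter_upwards [h (6 * s) (by positivity), eventually_ge_atTop 2] with n h1 hn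
  have hn0 : (0 : ℝ) ≤ n := Nat.cast_nonneg n
  have key : ((n : ℝ) ^ (-s)) ^ 6 ≤ q n ^ 6 := by
    calc ((n : ℝ) ^ (-s)) ^ 6 = (n : ℝ) ^ (-(6 * s)) := by
          rw [← Real.rpow_natCast, ← Real.rpow_mul hn0]; ring_nf
      _ ≤ blockProb 3 (criticalProbI 3) n := h1
      _ ≤ q n ^ 6 := hU n hn
  exact le_of_pow_le_pow_left₀ (by norm_num) (q_nonneg n) key

/-- The crux implies the anchor, using the registered necessity stub (certified once `stub_upperSandwich` lands). -/
theorem cubeSealSubpoly_of_crux' (h : Theses.PercNonProliferation.SubpolynomialBlocking) : CubeSealSubpoly :=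
  cubeSealSubpoly_of_crux upperSandwich_holds (crux_iff.mp h)

/-- NECESSITY of the transfer target: the upper seed sandwich and the crux give `SeedSubpoly k` for `k ≥ 2`
(`n^{-6s} ≤ u_n ≤ seed_k(n)⁶`). -/
theorem seedSubpoly_of_crux (hU : UpperSeedSandwich) {k : ℕ} (hk : 2 ≤ k)
    (h : SubpolynomialBlockingAt 3 (criticalProbI 3)) : SeedSubpoly k := by
  rw [subpolynomialBlockingAt_iff] at h
  intro s hs
  filter_upwards [h (6 * s) (by positivity), eventually_ge_atTop 3] with n h1 hn
  have hn0 : (0 : ℝ) ≤ n := Nat.cast_nonneg n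
  have key : ((n : ℝ) ^ (-s)) ^ 6 ≤ seed k n ^ 6 := by
    calc ((n : ℝ) ^ (-s)) ^ 6 = (n : ℝ) ^ (-(6 * s)) := by
          rw [← Real.rpow_natCast, ← Real.rpow_mul hn0]; ring_nf
      _ ≤ blockProb 3 (criticalProbI 3) n := h1
      _ ≤ seed k n ^ 6 := hU k n hk hn
  exact le_of_pow_le_pow_left₀ (by norm_num) (seed_nonneg k n) key

/-- **The crux is EQUIVALENT to the sub-polynomial flat seal of ONE aspect ratio** `1 + 1/k`, for every `k ≥ 2`
(stubs 1, 2: `⇐`; stub 6: `⇒`). Certified reduction of the annulus crux to a single flat-box quantity. -/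
theorem crux_iff_seedSubpoly {k : ℕ} (hk : 2 ≤ k) :
    Theses.PercNonProliferation.SubpolynomialBlocking ↔ SeedSubpoly k :=
  ⟨fun h => seedSubpoly_of_crux upperSeedSandwich_holds hk (crux_iff.mp h),
    fun h => crux_iff.mpr (subpolynomialBlockingAt_of_seedSubpoly sixSlabSandwich_holds seedTiling_holds
      (le_trans (by norm_num) hk) h)⟩

/-! ### The composition: the four stubs imply the crux, by name -/

/-- **`SubpolynomialBlocking` from the four stubs** (no `sorry` outside the stubs): `u_n ≥ V_n⁶ ≥ seed_k(n)^{6K} ≥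
(c q_n^C)^{6K} ≥ n^{-s}` eventually; entry into the crux through the landed `Negative.crux_iff` (`Iff.rfl`). -/
theorem SubpolynomialBlocking_of (h₁ : Registered.stub_sixSlab) (h₂ : Registered.stub_tiling)
    (h₃ : Registered.stub_comparison) (h₄ : Registered.stub_anchor) :
    Theses.PercNonProliferation.SubpolynomialBlocking :=
  crux_iff.mpr (subpolynomialBlockingAt_of h₁ h₂ h₃ h₄)

/-- Wiring check: the registered stubs feed `SubpolynomialBlocking_of` as stated. -/
theorem SubpolynomialBlocking_proof : Theses.PercNonProliferation.SubpolynomialBlocking :=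
  SubpolynomialBlocking_of stub_sixSlab stub_tiling stub_comparison stub_anchor

end Summit.CriticalPhenomena.PercolationContinuityZ3.Cruxes.SubpolynomialBlocking.CrossSandwichFlatSeal

end
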